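import Summits.KontsevichZagierPeriods.Zeta5Search.WedgeDictionaryDescent22Transport
import Summits.KontsevichZagierPeriods.Zeta5Search.WedgeDictionaryIntegralPartPQ
import Summits.KontsevichZagierPeriods.Zeta5Search.WedgeDictionaryLevelDescentProof
import HarnessLib

/-!
# The `P̂`-third of the analytic wedge dictionary follows from Brown–Zudilin (22) and the proved level descent (gen-1 g10)

HONEST FRAMING: systematic search; no irrationality claim unless certified.

OUR work (Summit side; cell `pub-zeta5`, planner gen-1 g10, 2026-08-20).  The open half of the wedge dictionary is
`explicitPQ` (`WedgeDictionaryIntegralPartPQ`): `I(a) = Q(a)(2ζ(5)+4ζ(3)ζ(2)) − 4ρ(UV′−U′V)ζ(2) − 2ρ(W′V−WV′)`.  Its `ζ(2)`-companion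
("`P̂`-third") says `I(a) = Q(a)(2ζ(5)+4ζ(3)ζ(2)) − 4ρ(UV′−U′V)ζ(2) − 2P` for SOME rational `P` (`phatPartResidue`).  This file is a
KERNEL-CHECKED REDUCTION of that statement, in Brown–Zudilin's residue range `p₄+q₄ ≤ p₃`, to three CITED facts and the tree:

  `descent22` (Brown–Zudilin (22), typed in `Literature/…/BrownZudilin2022/DescentToZetaThree`)
  ∧ `Zudilin2002.vwp_eq_integral_of_pos` (k = 3: the generalised Beukers integral `J₃` is `λ·F̃₅(B)`)
  ∧ `Zudilin2004.baileyTransform` (the Rhin–Viola/Bailey invariance of `F̃₅(B)/Π(B)`)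
  ⟹ `phatPartResidue`                                                      (`phatPart_of_descent22`),

using the PROVED level-descent identities `levelDescentW_holds`, `levelDescentV_holds` (gen-1 g6–g8 / P1), the PROVED `Q`-half
`wedgeDictionary_Q`, the decomposition theorem `vwp_decomposition` with `LevelDescent.coeffU_eq_zero_of_slot_one`, and the
TRANSPORT DICTIONARY proved in `WedgeDictionaryDescent22Transport`: (i) `J₃`-parameters of the `k`-th term of (22) ↦ the level-`(p₁+q₁+q₂)` vector
`B(k) = (p₁+q₁+q₂; p₀, p₃−k, p₁, q₂, p₁+q₁−p₂)` (`bFive`); (ii) Zudilin's involution `𝔱₁₃₄` carries `B(k)` to the level-`N` vector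
`(N; b₃, b₇−i, b₄, b₆, b₅)`, `i = k − p₄`, `N = b₀` (`tau134_bFive`); (iii) the slot-symmetric level-5 series at that vector is the
level-7 series at the DEGENERATE SHAPE `degShape b i = (N; N+1, 0, b₃, b₄, b₅, b₆, b₇−i)` (`vwpDual_tShape`); (iv) the weights
match: `w_k·λ_k·Π(B(k))/Π(𝔱B(k)) = 2ρ(a)·Ω_i(b)` (`transportWeight`, a relabelling of factorials through (18)–(19) of the source —
no summation identity is involved); (v) the binomial support of (22) is exactly the `i`-range of the level descent
(`b₇ − b₁ = p₆ − p₄`, `b₇ − b₂ = p₅ − p₄`, `c₁₂ = q₄`).  So the provenance recorded in `WedgeDictionaryLevelDescent` ("LD is (22)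
transported to the dual side") is now a theorem of the tree, read in the direction (22) ⟹ P̂-part.

RANGE.  Besides the region of `explicitPQ` and the residue range, the theorem assumes the level-descent hypotheses (`2b_k ≤ b₀`),
non-negative `(p;q)`, the provisos of `descent22`, and STRICT admissibility (Zudilin 2004, (4.12): all sixteen `c_jk > 0`) of every
`B(k)` in the support — the typed Bailey fact is stated on the open admissible cone only.  Terms of (22) whose `B(k)` has a zero
parameter (e.g. `k = p₃`, or `p₀ = 0`; this includes the source's first example `a = (1,…,1)`) are therefore NOT covered here; they need
the same invariance on the closed cone (a one-line extension of the cited statement, not typed).  All hypotheses are decidable linear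
conditions on `(a, j)`.

What this is NOT: a proof of `explicitPQ` (its `ζ(5)`-companion `P = ρ(W′V − WV′)` has no printed handle at all — Brown–Zudilin
print no formula for `P(a)`), nor of (22); nor anything about irrationality.
-/

noncomputable section

open Finset

namespace Summit.KontsevichZagierPeriods.Zeta5Search.WedgeDictionary

open Summit.KontsevichZagierPeriods.Zeta5Search.DualSeries
open Literature.NumberTheory.Irrationality.BrownZudilin2022
  (vwpDual hOfB bOfA pOf qOf Converges cellularIntegral QOf zchoose J3 w22 rhs22 J3TermsConverge descent22)
open Literature.NumberTheory.Irrationality.Zudilin2002 (vwpSeries sorokinIntegral sorokinIntegrand vwp_eq_integral_of_pos)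
open Literature.NumberTheory.Irrationality.Zudilin2004 (Admissible cParams piNorm tau134 baileyTransform vwpDual_comp_swap)
open Literature.NumberTheory.Transcendental (zetaValue)

/-! ### The statement -/

/-- STRICT admissibility (Zudilin 2004 (4.12)) of every `B(k)` in the binomial support of (22). Decidable. -/
def StrictTerms (a : Fin 8 → ℤ) : Prop :=
  ∀ k ∈ Icc (pOf a 4) (pOf a 4 + qOf a 3), pOf a 5 ≤ k → pOf a 6 ≤ k → Admissible (bFive a k)

/-- `StrictTerms` is decidable (finitely many integer sign conditions). -/
instance (a : Fin 8 → ℤ) : Decidable (StrictTerms a) := by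
  unfold StrictTerms; infer_instance

/-- **The `P̂`-third of the analytic wedge dictionary in the residue range (INTERNALLY MINTED obligation node; implied by
`explicitPQ` — `phatPart_of_explicitPQ` — and, modulo three cited facts, PROVED — `phatPart_of_descent22`).**  For `a`, `j` in the
region of `explicitPQ` with moreover `2b_k ≤ b₀` (level-descent box), `(p;q) ≥ 0`, `p₄+q₄ ≤ p₃`, the provisos `J3TermsConverge` and
`StrictTerms`: `∃ P ∈ ℚ, I(a) = Q(a)(2ζ(5) + 4ζ(3)ζ(2)) − 4ρ(a)(U(b)V(b′) − U(b′)V(b))ζ(2) − 2P`, `b = b(a)`, `b′ = b + e_j`. -/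
@[conjecture] def phatPartResidue : Prop :=
  ∀ (a : Fin 8 → ℤ) (j : ℕ), j ∈ Icc 1 7 → Converges a →
    (∀ i ∈ Icc 1 7, 0 ≤ bOfA a i ∧ 2 * bOfA a i ≤ bOfA a 0 + 1) → 0 ≤ dOf (bOfA a) →
    2 * (bOfA a j + 1) ≤ bOfA a 0 + 1 → (∀ i ∈ Icc 1 7, 2 * bOfA a i ≤ bOfA a 0) →
    (∀ i, 0 ≤ pOf a i) → (∀ i, 0 ≤ qOf a i) → pOf a 4 + qOf a 3 ≤ pOf a 3 →
    J3TermsConverge (pOf a) (qOf a) → StrictTerms a →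
    ∃ P : ℚ, cellularIntegral a =
      (QOf a : ℝ) * (2 * zetaValue 5 + 4 * zetaValue 3 * zetaValue 2) -
        4 * ((rhoOf a * (coeffU (bOfA a) * coeffV (Function.update (bOfA a) j (bOfA a j + 1)) -
              coeffU (Function.update (bOfA a) j (bOfA a j + 1)) * coeffV (bOfA a)) : ℚ) : ℝ) * zetaValue 2 -
        2 * (P : ℝ)

/-! Sanity check (not citable): the thirteen hypotheses are jointly satisfiable — e.g. `a = (1,1,1,2,1,2,1,1)`, `j = 2`
(cell census `code/gen1/g10/nonvacuity.py`: 3946 points of the box `{1,…,4}⁸` satisfy all of them, 8936 all but `StrictTerms`). -/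
example :
    let a : Fin 8 → ℤ := ![1, 1, 1, 2, 1, 2, 1, 1]
    Converges a ∧ (∀ i ∈ Icc 1 7, 0 ≤ bOfA a i ∧ 2 * bOfA a i ≤ bOfA a 0 + 1) ∧ 0 ≤ dOf (bOfA a) ∧
      2 * (bOfA a 2 + 1) ≤ bOfA a 0 + 1 ∧ (∀ i ∈ Icc 1 7, 2 * bOfA a i ≤ bOfA a 0) ∧ (∀ i, 0 ≤ pOf a i) ∧ (∀ i, 0 ≤ qOf a i) ∧
      pOf a 4 + qOf a 3 ≤ pOf a 3 ∧ J3TermsConverge (pOf a) (qOf a) ∧ StrictTerms a := by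
  decide

/-- The easy direction: `explicitPQ` gives `phatPartResidue` with `P = ρ(W′V − WV′)`. -/
theorem phatPart_of_explicitPQ (h : explicitPQ) : phatPartResidue := by
  intro a j hj hconv hreg hd hpart _ _ _ _ _ _
  exact ⟨_, h a j hj hconv hreg hd hpart⟩

/-! ### The term identity and the assembly -/

/-- `𝔱₁₃₄` preserves admissibility (it permutes the sixteen parameters). -/
theorem admissible_tau134 {B : ℕ → ℤ} (hB : Admissible B) : Admissible (tau134 B) := by
  rw [Literature.NumberTheory.Irrationality.Zudilin2004.tau134_eq]
  exact Literature.NumberTheory.Irrationality.Zudilin2004.admissible_comp_swap35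
    (Literature.NumberTheory.Irrationality.Zudilin2004.admissible_tau
      (Literature.NumberTheory.Irrationality.Zudilin2004.admissible_comp_swap35 hB))

/-- The sixteen strict inequalities of `Admissible (tShape a k)`, unfolded. -/
theorem tShape_ineqs (a : Fin 8 → ℤ) (k : ℤ) (h : Admissible (tShape a k)) :
    0 < bOfA a 3 ∧ 0 < bOfA a 7 - (k - pOf a 4) ∧ 0 < bOfA a 4 ∧ 0 < bOfA a 6 ∧ 0 < bOfA a 5 ∧
      0 < 2 * bOfA a 0 - (bOfA a 3 + (bOfA a 7 - (k - pOf a 4)) + bOfA a 4 + bOfA a 6 + bOfA a 5) ∧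
      0 < bOfA a 0 - bOfA a 3 - (bOfA a 7 - (k - pOf a 4)) := by
  unfold Admissible cParams at h
  simp only [List.mem_cons, List.not_mem_nil, or_false, forall_eq_or_imp, forall_eq] at h
  simp only [tShape] at h
  norm_num at h
  omega

/-- The degenerate shape lies in the box of `vwp_decomposition` (`0 ≤ slot ≤ N+1`). -/
theorem inBox_degShape (b : ℕ → ℤ) (i : ℤ) (h0 : 0 ≤ b 0) (h3 : 0 ≤ b 3 ∧ b 3 ≤ b 0 + 1) (h4 : 0 ≤ b 4 ∧ b 4 ≤ b 0 + 1)
    (h5 : 0 ≤ b 5 ∧ b 5 ≤ b 0 + 1) (h6 : 0 ≤ b 6 ∧ b 6 ≤ b 0 + 1) (h7 : 0 ≤ b 7 - i ∧ b 7 - i ≤ b 0 + 1) :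
    InBox (degShape b i) := by
  refine ⟨by simpa [degShape] using h0, fun s hs => ?_⟩
  have hs' := mem_range.1 hs
  interval_cases s <;> (simp [degShape]; try omega)

/-- The slot sum of the degenerate shape. -/
theorem sum_degShape (b : ℕ → ℤ) (i : ℤ) :
    ∑ j ∈ range 7, degShape b i (j + 1) = b 0 + 1 + b 3 + b 4 + b 5 + b 6 + (b 7 - i) := by
  simp only [sum_range_succ, sum_range_zero, degShape]
  norm_num
  try ring

/-- `Π(B) ≠ 0`. -/
theorem piNorm_ne_zero (B : ℕ → ℤ) : (piNorm B : ℝ) ≠ 0 := by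
  unfold piNorm
  exact_mod_cast Nat.mul_ne_zero (prod_ne_zero_iff.2 fun _ _ => Nat.factorial_ne_zero _) (Nat.factorial_ne_zero _)

/-- One term of (22) = one term of the level descent (times `2ρ`), as real numbers. -/
theorem term22_eq (hZ : vwp_eq_integral_of_pos) (hB : baileyTransform) (hT : transportWeight_stmt)
    (a : Fin 8 → ℤ) (k : ℤ) (hreg : ∀ i ∈ Icc 1 7, 0 ≤ bOfA a i ∧ 2 * bOfA a i ≤ bOfA a 0 + 1) (hd : 0 ≤ dOf (bOfA a))
    (hp : ∀ i, 0 ≤ pOf a i) (hq : ∀ i, 0 ≤ qOf a i) (hk : k ∈ Icc (pOf a 4) (pOf a 4 + qOf a 3)) (h5 : pOf a 5 ≤ k)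
    (h6 : pOf a 6 ≤ k) (hJ : J3TermsConverge (pOf a) (qOf a)) (hadm : Admissible (bFive a k)) :
    (w22 (pOf a) (qOf a) k : ℝ) * J3 (pOf a 0) (pOf a 1) (pOf a 2) (pOf a 3 - k) (qOf a 0) (qOf a 1) (qOf a 2 - pOf a 6 + k) =
      ((2 * rhoOf a * ldWeight (bOfA a) (k - pOf a 4) : ℚ) : ℝ) *
        ((coeffW (degShape (bOfA a) (k - pOf a 4)) : ℝ) * zetaValue 3 - coeffV (degShape (bOfA a) (k - pOf a 4))) := by
  have hadmT : Admissible (tShape a k) := by rw [← tau134_bFive]; exact admissible_tau134 hadm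
  obtain ⟨t3, t7, t4, t6, t5, tS, t37⟩ := tShape_ineqs a k hadmT
  have r3 := hreg 3 (by simp)
  have r4 := hreg 4 (by simp)
  have r5 := hreg 5 (by simp)
  have r6 := hreg 6 (by simp)
  have r7 := hreg 7 (by simp)
  have hN : 0 ≤ bOfA a 0 := by omega
  have hIn : InBox (degShape (bOfA a) (k - pOf a 4)) :=
    inBox_degShape _ _ hN ⟨r3.1, by omega⟩ ⟨r4.1, by omega⟩ ⟨r5.1, by omega⟩ ⟨r6.1, by omega⟩ ⟨by omega, by omega⟩
  have hsum : ∑ j ∈ range 7, degShape (bOfA a) (k - pOf a 4) (j + 1) ≤ 3 * degShape (bOfA a) (k - pOf a 4) 0 + 1 := by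
    rw [sum_degShape]; simp only [degShape]; norm_num; omega
  have hU : coeffU (degShape (bOfA a) (k - pOf a 4)) = 0 :=
    LevelDescent.coeffU_eq_zero_of_slot_one _ hIn hsum (by simp [degShape])
  have hdec := (vwp_decomposition _ hIn hsum).2
  rw [hU] at hdec
  -- the analytic chain
  have hJ3 := J3_eq_vwpDual_five hZ a k hadm
  have hBT := baileyTransform.slots134 hB (bFive a k) hadm
  rw [tau134_bFive] at hBT
  have hπB0 := piNorm_ne_zero (bFive a k)
  have hπT0 := piNorm_ne_zero (tShape a k)
  have hv : vwpDual 5 (bFive a k) = (piNorm (bFive a k) : ℝ) / (piNorm (tShape a k) : ℝ) * vwpDual 5 (tShape a k) := by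
    rw [div_eq_div_iff hπB0 hπT0] at hBT
    field_simp
    linarith
  have hπB : (piNorm (bFive a k) : ℝ) = ((piB a k : ℚ) : ℝ) := by
    rw [← piNorm_bFive]; push_cast; rfl
  have hπT : (piNorm (tShape a k) : ℝ) = ((piT a k : ℚ) : ℝ) := by
    rw [← piNorm_tShape]; push_cast; rfl
  have hTw := hT a k hreg hd hp hq hk h5 h6 hJ hadm
  have hTw' : ((w22 (pOf a) (qOf a) k : ℚ) : ℝ) * ((lamQ a k : ℚ) : ℝ) * ((piB a k : ℚ) : ℝ) =
      ((2 * rhoOf a * ldWeight (bOfA a) (k - pOf a 4) : ℚ) : ℝ) * ((piT a k : ℚ) : ℝ) := by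
    exact_mod_cast congrArg (fun x : ℚ => (x : ℝ)) hTw
  have hπT0' : ((piT a k : ℚ) : ℝ) ≠ 0 := by rw [← hπT]; exact hπT0
  rw [hJ3, hv, vwpDual_tShape a k hN, hdec, hπB, hπT]
  have hw : (w22 (pOf a) (qOf a) k : ℝ) = ((w22 (pOf a) (qOf a) k : ℚ) : ℝ) := by push_cast; rfl
  rw [hw]
  calc ((w22 (pOf a) (qOf a) k : ℚ) : ℝ) * (((lamQ a k : ℚ) : ℝ) * (((piB a k : ℚ) : ℝ) / ((piT a k : ℚ) : ℝ) *
          ((0 : ℚ) * zetaValue 5 + (coeffW (degShape (bOfA a) (k - pOf a 4)) : ℝ) * zetaValue 3 -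
            coeffV (degShape (bOfA a) (k - pOf a 4)))))
        = ((w22 (pOf a) (qOf a) k : ℚ) : ℝ) * ((lamQ a k : ℚ) : ℝ) * ((piB a k : ℚ) : ℝ) / ((piT a k : ℚ) : ℝ) *
          ((coeffW (degShape (bOfA a) (k - pOf a 4)) : ℝ) * zetaValue 3 - coeffV (degShape (bOfA a) (k - pOf a 4))) := by
          push_cast; ring
    _ = _ := by rw [hTw']; field_simp

/-- **THE REDUCTION.**  Brown–Zudilin (22) ∧ Zudilin 2002 (k = 3) ∧ Bailey/Rhin–Viola invariance ⟹ the `P̂`-third of the analytic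
wedge dictionary in the residue range (with the level-descent theorems and the `Q`-half of the tree). -/
theorem phatPart_of_descent22 (h22 : descent22) (hZ : vwp_eq_integral_of_pos) (hB : baileyTransform) : phatPartResidue := by
  intro a j hj hconv hreg hd hpart h2b hp hq hres hJ hstrict
  obtain ⟨P, hI⟩ := h22 a hconv hp hq hres hJ
  refine ⟨P, ?_⟩
  have hT := transportWeight
  have e71 : bOfA a 7 - bOfA a 1 = pOf a 6 - pOf a 4 := by simp [bOfA, pOf]; ring
  have e72 : bOfA a 7 - bOfA a 2 = pOf a 5 - pOf a 4 := by simp [bOfA, pOf]; ring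
  have e12 : bOfA a 0 - bOfA a 1 - bOfA a 2 = qOf a 3 := by simp [bOfA, qOf]
  have e7 : bOfA a 7 = pOf a 3 - pOf a 4 := by simp [bOfA, pOf]; ring
  have hIn : InBox (bOfA a) := inBox_of_region (bOfA a) hreg hj hpart
  have hc12 : bOfA a 0 - bOfA a 1 - bOfA a 2 ≤ bOfA a 7 := by rw [e12, e7]; linarith
  have hmin : min (bOfA a 0 - bOfA a 1 - bOfA a 2) (bOfA a 7) = qOf a 3 := by rw [min_eq_left hc12, e12]
  -- clause 2 of the level descent (convergence of the degenerate shapes) from strict admissibility of the first term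
  have hcl2 : bOfA a 0 - bOfA a 1 - bOfA a 2 ≤ dOf (bOfA a) + max 0 (max (bOfA a 7 - bOfA a 1) (bOfA a 7 - bOfA a 2)) := by
    rw [e71, e72, e12]
    by_cases hle : max 0 (max (pOf a 6 - pOf a 4) (pOf a 5 - pOf a 4)) ≤ qOf a 3
    · have hk0 : pOf a 4 + max 0 (max (pOf a 6 - pOf a 4) (pOf a 5 - pOf a 4)) ∈ Icc (pOf a 4) (pOf a 4 + qOf a 3) :=
        mem_Icc.2 ⟨by omega, by omega⟩
      have hadm := hstrict _ hk0 (by omega) (by omega)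
      have hadmT : Admissible (tShape a (pOf a 4 + max 0 (max (pOf a 6 - pOf a 4) (pOf a 5 - pOf a 4)))) := by
        rw [← tau134_bFive]; exact admissible_tau134 hadm
      obtain ⟨-, -, -, -, -, tS, -⟩ := tShape_ineqs a _ hadmT
      rw [dOf_bOfA]
      simp [bOfA, pOf, qOf] at tS ⊢
      omega
    · push Not at hle; linarith
  have hW := levelDescentW_holds (bOfA a) j hj hIn h2b hd hcl2
  have hV := levelDescentV_holds (bOfA a) j hj hIn h2b hd hc12 hcl2
  have hQ := wedgeDictionary_Q a j hj hconv hreg hd hpart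
  rw [hmin] at hW hV
  rw [hW] at hQ
  -- the key identity: RHS(22) = 2Q ζ(3) − 2ρ·(UV′ − U′V)
  have key : rhs22 (pOf a) (qOf a) = 2 * ((QOf a : ℚ) : ℝ) * zetaValue 3 -
      2 * ((rhoOf a * (coeffU (bOfA a) * coeffV (Function.update (bOfA a) j (bOfA a j + 1)) -
              coeffU (Function.update (bOfA a) j (bOfA a j + 1)) * coeffV (bOfA a)) : ℚ) : ℝ) := by
    rw [hQ, hV]
    set iLo := max 0 (max (bOfA a 7 - bOfA a 1) (bOfA a 7 - bOfA a 2)) with hi_def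
    have hi' : iLo = max 0 (max (pOf a 6 - pOf a 4) (pOf a 5 - pOf a 4)) := by rw [hi_def, e71, e72]
    -- right-hand side as one sum
    have hR : 2 * (((rhoOf a * ∑ i ∈ Icc iLo (qOf a 3), ldWeight (bOfA a) i * coeffW (degShape (bOfA a) i)) : ℚ) : ℝ) *
          zetaValue 3 -
        2 * (((rhoOf a * ∑ i ∈ Icc iLo (qOf a 3), ldWeight (bOfA a) i * coeffV (degShape (bOfA a) i)) : ℚ) : ℝ) =
        ∑ i ∈ Icc iLo (qOf a 3), ((2 * rhoOf a * ldWeight (bOfA a) i : ℚ) : ℝ) *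
          ((coeffW (degShape (bOfA a) i) : ℝ) * zetaValue 3 - coeffV (degShape (bOfA a) i)) := by
      push_cast
      rw [Finset.mul_sum, Finset.mul_sum, Finset.mul_sum, Finset.sum_mul, Finset.mul_sum, ← Finset.sum_sub_distrib]
      refine Finset.sum_congr rfl fun i _ => ?_
      ring
    rw [hR]
    -- left-hand side: restrict to the support, then reindex `k = p₄ + i`
    unfold rhs22
    have hsub : Icc (pOf a 4 + iLo) (pOf a 4 + qOf a 3) ⊆ Icc (pOf a 4) (pOf a 4 + qOf a 3) :=
      Icc_subset_Icc (by rw [hi']; omega) le_rfl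
    rw [← Finset.sum_subset hsub]
    · rw [← Finset.map_add_left_Icc, Finset.sum_map]
      refine Finset.sum_congr rfl fun i hi => ?_
      have hi2 := mem_Icc.1 hi
      have hk : pOf a 4 + i ∈ Icc (pOf a 4) (pOf a 4 + qOf a 3) := mem_Icc.2 ⟨by rw [hi'] at hi2; omega, by omega⟩
      have h5 : pOf a 5 ≤ pOf a 4 + i := by rw [hi'] at hi2; omega
      have h6 : pOf a 6 ≤ pOf a 4 + i := by rw [hi'] at hi2; omega
      have := term22_eq hZ hB hT a (pOf a 4 + i) hreg hd hp hq hk h5 h6 hJ (hstrict _ hk h5 h6)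
      simpa only [addLeftEmbedding_apply, add_sub_cancel_left] using this
    · intro k hk hk'
      have hk2 := mem_Icc.1 hk
      have hlt : k < pOf a 6 ∨ k < pOf a 5 := by
        rw [hi'] at hk'
        simp only [mem_Icc, not_and, not_le] at hk'
        have := hk' 
        by_contra hcon
        push Not at hcon
        have := this (by omega)
        omega
      have hw0 : w22 (pOf a) (qOf a) k = 0 := by
        unfold w22
        rcases hlt with h | h
        · rw [show zchoose k (pOf a 6) = 0 by rw [zchoose, if_neg (by omega)]]; ring
        · rw [show zchoose (qOf a 4) (k - pOf a 5) = 0 by rw [zchoose, if_neg (by omega)]]; ring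
      rw [hw0]; simp
  rw [hI, key]
  push_cast
  ring

end Summit.KontsevichZagierPeriods.Zeta5Search.WedgeDictionary
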